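import Mathlib
import HarnessLib
import Summits.HubbardSuperconductivity.HubbardSuperconductivity.Theorems.KLProgrammeKLRegimeCountertermJacksonRemainderFlow
import Summits.HubbardSuperconductivity.HubbardSuperconductivity.Theorems.KLProgrammeKLRegimeCountertermJacksonFrameBounds
import Summits.HubbardSuperconductivity.HubbardSuperconductivity.Theorems.KLProgrammeKLRegimeCountertermMuFlowExt
import Summits.HubbardSuperconductivity.HubbardSuperconductivity.Theorems.KLProgrammeKLRegimeSplitTwoLegIncrementSizes
import Summits.HubbardSuperconductivity.HubbardSuperconductivity.Theorems.KLProgrammeKLRegimeSplitTwoLegSizesMSOfCurveJet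
import Summits.HubbardSuperconductivity.HubbardSuperconductivity.Theorems.KLProgrammeKLRegimeSplitFrameFnLemmas
import Summits.HubbardSuperconductivity.HubbardSuperconductivity.Theorems.KLProgrammeKLRegimeSplitSlotsV17F2

/-!
# Route `KLProgramme`, crux K3 — gen-8 ENGINE-FLOW child (stmt-HubbardSuperconductivity-20437 `KLRegimeEngineV17F2`), v2 token #19 /
# located risk «#19-ROOM», plan g19 (R59al) question (K5): the flow piece is ITS ANGULAR MEAN PLUS the Jackson mean of its MEAN-FREE part —
# exact decomposition, the sup bridge «reading oscillation ⇒ piece oscillation» (same constant), what `HistP` alone gives, and the δμ bookkeeping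
# of the flow frame (cell gate-hubbard-kl, seat hubbard-kl-r2d-p1 g9; memo `K5-ANSWER-r2dp1-g9.md`, evidence #55 on 20437)

THE POINT.  The (c-D) telescoping of the (b) tower (k3c3-p2 CD-LIMITS, E1 WORD10) wants the order-0 size of the scale-`m` flow pieces in `U²`
currency; the registered `FlowPieceJetsAt` books `uPow 0 U = |U|` because the piece CONTAINS the scale-`m` tadpole (first order, momentum-independent,
BGM 2006 (2.36)).  By construction (`klFrameExtFn`: «constant part untouched, mean-free part flat along rays», …SplitFrameFn; `jsmooth_const`: the Jackson mean
reproduces constants) that first-order part is EXACTLY A CONSTANT — the angular mean of the cumulative reading `ν_m = klLocalPart … (K_m) m` —, so the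
piece splits as `mean + (smoothed mean-free part)` and only the second summand needs a currency.  This file proves, scheme-generically and with no new
definition:

* §1 `abs_eval_jacksonFrame_sub_const_le` (generic: `|F − c| ≤ B` on a continuous symmetric frame ⇒ `|𝒥_d F − c| ≤ B`), `jsmooth_eq_const_add_jsmooth_sub`;
* §2 **`eval_klFlowPiece_eq_mean_add_jsmooth`** — `(klFlowPiece m)(p) = klAngularMean ν_m + 𝒥_{klFlowDeg m}[χ_flat·(ν_m∘angle − klAngularMean ν_m)](p)`
  EXACTLY (for `ν_m ∈ C⁴`, `μ ∈ klWindowC`), and **`abs_eval_klFlowPiece_sub_mean_le`** — THE BRIDGE: `|ν_m(θ) − mean ν_m| ≤ B` for all `θ` ⇒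
  `|(klFlowPiece m)(p) − mean ν_m| ≤ B` for all `p` (the SAME constant; `evalM` form too);
* §3 what the registered history ALONE gives (the (a)-path of (R59al)(iii)): by k3c3-p3's `abs_sub_klAngularMean_le_of_deriv` (a `2π`-periodic `C¹` profile is
  within `2π·sup|f′|` of its mean), from `TwoLegReadJetsF … m` (k = 1) **`abs_eval_klFlowPiece_sub_mean_le_of_readJetsF`**:
  `|(klFlowPiece m)(p) − mean ν_m| ≤ 2π·curveJetBar G.S Q.S' U 1 m = 2π(S₁ + S₁′|U|)·U²·4^{−m}` — `U²` currency at RATE `4^{−m}` (not the `16^{−m}` the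
  telescoping needs: memo §(4)) —, and the same from `HistP klPredsV17F2` at every `m < n`;
* §4 the δμ bookkeeping: `|klAngularMean ν_m| ≤ R.cr·|U|·Λ_m²/e₀ = R.cr·|U|·e₀·16^{−m}` from `RenormalisedAtF` (hence from `HistP`), the flow frame as
  «minus the sum of the means, minus the sum of the mean-free pieces» (`eval_klFlowFrameU_eq_neg_sum_mean_sub`), and `|Σ_{m<n} mean ν_m| ≤ (16/15)·R.cr·e₀·|U|`.

Proofs only; no definitions; nothing about the Hubbard model is asserted (every statement is an implication from the named slot predicates or pure
calculus); nothing here asserts any stub of 20437, K3 or superconductivity.  References: BGM 2006 §2.3–2.4 (2.23), (2.36) [cite: BenfattoGiulianiMastropietro2006];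
BGM 2003 §2 (the constant part of the counterterm = chemical-potential renormalisation).
-/

noncomputable section

namespace Summit.HubbardSuperconductivity.HubbardSuperconductivity.Theorems.KLRegimeSplit

set_option linter.dupNamespace false -- summit = problem name (single-conjunct summit), D-0017

open Real Finset MeasureTheory Literature.MathematicalPhysics.QuantumLattice Literature.Probability.LatticeModels
open Literature.MathematicalPhysics.QuantumLattice.FermiRG
open Summit.HubbardSuperconductivity.HubbardSuperconductivity.Theorems.KLProgrammeLegKernels

/-! ## §1 Generic: the G-extension minus the mean; the Jackson mean of a frame close to a constant -/

section Generic

variable {μ : ℝ} {f : ℝ → ℝ}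

/-- The mean-free part of the G-extension is the cutoff times the mean-free profile read on the angle (unfolding). -/
theorem klFrameExtFn_sub_mean_apply (μ : ℝ) (f : ℝ → ℝ) (p : Fin 2 → ℝ) :
    klFrameExtFn μ f p - klAngularMean f = klFlatCutoffFn μ p * (f (polarAngle (centredRep p)) - klAngularMean f) := by
  unfold klFrameExtFn
  ring

/-- **The Jackson mean of a continuous symmetric frame within `B` of a constant `c` is within `B` of `c`** (mass one, positivity, constants reproduced). -/
theorem abs_eval_jacksonFrame_sub_const_le {F : FrameFn} (hc : Continuous F) (hsym : IsSymmetricFrame F) {c B : ℝ}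
    (hB : ∀ q, |F q - c| ≤ B) (d : ℕ) (p : Fin 2 → ℝ) : |(jacksonFrame d F).eval p - c| ≤ B := by
  obtain ⟨hper, hrefl, hswap⟩ := hsym
  rw [eval_jacksonFrame hc hper hrefl hswap d p]
  have h := jsmooth_sub d hc continuous_const (G := fun _ => c) p
  rw [jsmooth_const] at h
  rw [← h]
  exact abs_jsmooth_le d (hc.sub continuous_const) hB p

/-- **The Jackson mean splits off constants**: `𝒥_d F (p) = c + 𝒥_d (F − c)(p)` for continuous `F`. -/
theorem jsmooth_eq_const_add_jsmooth_sub {F : FrameFn} (hc : Continuous F) (c : ℝ) (d : ℕ) (p : Fin 2 → ℝ) :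
    jsmooth d F p = c + jsmooth d (fun q => F q - c) p := by
  have h := jsmooth_sub d hc continuous_const (G := fun _ => c) p
  rw [jsmooth_const] at h
  rw [h]
  ring

end Generic

/-! ## §2 The flow piece = mean + Jackson mean of the mean-free part; the sup bridge -/

section Model

variable {L M : ℕ} [NeZero L] [NeZero M]

/-- `μ ∈ klWindowC` implies the symmetry hypothesis `−39/10 ≤ μ` of the extension lemmas. -/
private theorem klWindowC_le {μ : ℝ} (hμ : μ ∈ klWindowC) : -(39 / 10 : ℝ) ≤ μ := by
  simp only [klWindowC, Set.mem_Icc] at hμ; linarith [hμ.1]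

/-- Continuity of the G-extension of a `C⁴` cumulative reading (`μ ∈ klWindowC`). -/
theorem continuous_klFrameExtFn_localPart {β U μ : ℝ} (hμ : μ ∈ klWindowC) {K : TrigPolyC4v} {n : ℕ}
    (hf : ContDiff ℝ 4 fun θ : ℝ => klLocalPart L M β U μ K n θ) :
    Continuous (klFrameExtFn μ fun θ => klLocalPart L M β U μ K n θ) :=
  continuous_klFrameExtFn_of_contDiff (contDiff_onM_klFrameExtFn (N := 4) hf (klLocalPart_periodic β U μ K n) hμ)

/-- **EXACT DECOMPOSITION OF THE FLOW PIECE**: for `μ ∈ klWindowC` and a `C⁴` cumulative reading `ν_m = klLocalPart … (K_m) m`,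
`(klFlowPiece m)(p) = klAngularMean ν_m + 𝒥_{klFlowDeg m}[q ↦ χ_flat(q)·(ν_m(angle q̃) − klAngularMean ν_m)](p)` — the ANGULAR MEAN (a constant: the
tadpole / δμ part) plus the Jackson mean of the flat-extended MEAN-FREE part. -/
theorem eval_klFlowPiece_eq_mean_add_jsmooth {β U μ : ℝ} (hμ : μ ∈ klWindowC) {m : ℕ}
    (hf : ContDiff ℝ 4 fun θ : ℝ => klLocalPart L M β U μ (klFlowFrameU L M β U μ m) m θ) (p : Fin 2 → ℝ) :
    (klFlowPiece L M β U μ m).eval p =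
      klAngularMean (fun θ => klLocalPart L M β U μ (klFlowFrameU L M β U μ m) m θ) +
        jsmooth (klFlowDeg m) (fun q => klFlatCutoffFn μ q *
          (klLocalPart L M β U μ (klFlowFrameU L M β U μ m) m (polarAngle (centredRep q)) -
            klAngularMean (fun θ => klLocalPart L M β U μ (klFlowFrameU L M β U μ m) m θ))) p := by
  have hsym := isSymmetricFrame_klFrameExtFn_localPart (L := L) (M := M) β U (klWindowC_le hμ) (klFlowFrameU L M β U μ m) m
  have hc := continuous_klFrameExtFn_localPart (L := L) (M := M) hμ hf
  obtain ⟨hper, hrefl, hswap⟩ := hsym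
  rw [klFlowPiece_eq_jacksonFrame, eval_jacksonFrame hc hper hrefl hswap,
    jsmooth_eq_const_add_jsmooth_sub hc (klAngularMean fun θ => klLocalPart L M β U μ (klFlowFrameU L M β U μ m) m θ)]
  congr 1
  refine congrArg (fun F => jsmooth (klFlowDeg m) F p) (funext fun q => ?_)
  exact klFrameExtFn_sub_mean_apply μ _ q

/-- **THE BRIDGE (reading oscillation ⇒ piece oscillation, same constant)**: if the scale-`m` cumulative reading is within `B` of its angular mean at
every angle, then the scale-`m` flow piece is within `B` of that mean at EVERY continuum momentum. -/
theorem abs_eval_klFlowPiece_sub_mean_le {β U μ : ℝ} (hμ : μ ∈ klWindowC) {m : ℕ}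
    (hf : ContDiff ℝ 4 fun θ : ℝ => klLocalPart L M β U μ (klFlowFrameU L M β U μ m) m θ) {B : ℝ}
    (hB : ∀ θ, |klLocalPart L M β U μ (klFlowFrameU L M β U μ m) m θ -
      klAngularMean (fun θ => klLocalPart L M β U μ (klFlowFrameU L M β U μ m) m θ)| ≤ B) (p : Fin 2 → ℝ) :
    |(klFlowPiece L M β U μ m).eval p - klAngularMean (fun θ => klLocalPart L M β U μ (klFlowFrameU L M β U μ m) m θ)| ≤ B := by
  rw [klFlowPiece_eq_jacksonFrame]
  exact abs_eval_jacksonFrame_sub_const_le (continuous_klFrameExtFn_localPart (L := L) (M := M) hμ hf)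
    (isSymmetricFrame_klFrameExtFn_localPart (L := L) (M := M) β U (klWindowC_le hμ) _ m)
    (fun q => abs_klFrameExtFn_sub_mean_le_of_forall μ hB q) _ p

/-- The bridge through `EuclideanSpace` (`evalM`, the currency of `FlowPieceJetsAt` at `j = 0`). -/
theorem abs_evalM_klFlowPiece_sub_mean_le {β U μ : ℝ} (hμ : μ ∈ klWindowC) {m : ℕ}
    (hf : ContDiff ℝ 4 fun θ : ℝ => klLocalPart L M β U μ (klFlowFrameU L M β U μ m) m θ) {B : ℝ}
    (hB : ∀ θ, |klLocalPart L M β U μ (klFlowFrameU L M β U μ m) m θ -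
      klAngularMean (fun θ => klLocalPart L M β U μ (klFlowFrameU L M β U μ m) m θ)| ≤ B) (q : Momentum) :
    |evalM (klFlowPiece L M β U μ m) q - klAngularMean (fun θ => klLocalPart L M β U μ (klFlowFrameU L M β U μ m) m θ)| ≤ B := by
  rw [evalM_apply]
  exact abs_eval_klFlowPiece_sub_mean_le hμ hf hB _

/-- **The constant part is bounded by the sup of the piece's source**: `|mean ν_m| ≤ B₀` whenever `|ν_m| ≤ B₀` everywhere (re-export, for the table). -/
theorem abs_klAngularMean_localPart_le {β U μ : ℝ} {K : TrigPolyC4v} {n : ℕ} {B₀ : ℝ}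
    (h : ∀ θ, |klLocalPart L M β U μ K n θ| ≤ B₀) : |klAngularMean (fun θ => klLocalPart L M β U μ K n θ)| ≤ B₀ :=
  abs_klAngularMean_le' h

/-! ## §3 What the registered history alone gives: the mean-free part from the SLOPE jet (`U²` currency, rate `4^{−m}`) -/

/-- The `k = 1` curve-jet bar is `(c 1 + c' 1·|U|)·U²·4^{−m}`. -/
theorem curveJetBar_one (c c' : ℕ → ℝ) (U : ℝ) (m : ℕ) :
    curveJetBar c c' U 1 m = (c 1 + c' 1 * |U|) * U ^ 2 * ((4 : ℝ) ^ m)⁻¹ := by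
  rw [curveJetBar_apply, uPow_of_ne_zero one_ne_zero]
  congr 1
  rw [show ((1 : ℕ) : ℤ) - 2 = -1 by norm_num, neg_one_mul, zpow_neg, zpow_natCast]

/-- **From the reading jets alone**: `TwoLegReadJetsF … m` (its `k = 1` clause and `C⁴`) puts the scale-`m` cumulative reading within
`2π·curveJetBar G.S Q.S' U 1 m` of its angular mean. -/
theorem abs_klLocalPart_sub_mean_le_of_readJetsF {G : GeoConsts} {Q : EngConsts} {β U μ : ℝ} {m : ℕ}
    (h : TwoLegReadJetsF L M G Q β U μ m) (θ : ℝ) :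
    |klLocalPart L M β U μ (klFlowFrameU L M β U μ m) m θ -
        klAngularMean (fun θ => klLocalPart L M β U μ (klFlowFrameU L M β U μ m) m θ)| ≤
      2 * π * curveJetBar G.S Q.S' U 1 m := by
  have hd : Differentiable ℝ fun θ : ℝ => klLocalPart L M β U μ (klFlowFrameU L M β U μ m) m θ :=
    h.1.differentiable (by norm_num)
  refine abs_sub_klAngularMean_le_of_deriv hd (klLocalPart_periodic β U μ _ m) (fun θ => ?_) θ
  have h1 := h.2 1 (by norm_num) θ
  rwa [iteratedDeriv_one] at h1

/-- **The (a)-path of (R59al)(iii), kernel-checked**: from `TwoLegReadJetsF … m` and `μ ∈ klWindowC`, the scale-`m` flow piece is within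
`2π·curveJetBar G.S Q.S' U 1 m = 2π(S₁ + S₁′|U|)·U²·4^{−m}` of its constant part at every continuum momentum — `U²` currency, rate `4^{−m}`. -/
theorem abs_eval_klFlowPiece_sub_mean_le_of_readJetsF {G : GeoConsts} {Q : EngConsts} {β U μ : ℝ} (hμ : μ ∈ klWindowC) {m : ℕ}
    (h : TwoLegReadJetsF L M G Q β U μ m) (p : Fin 2 → ℝ) :
    |(klFlowPiece L M β U μ m).eval p - klAngularMean (fun θ => klLocalPart L M β U μ (klFlowFrameU L M β U μ m) m θ)| ≤
      2 * π * curveJetBar G.S Q.S' U 1 m :=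
  abs_eval_klFlowPiece_sub_mean_le hμ h.1 (abs_klLocalPart_sub_mean_le_of_readJetsF h) p

/-- The same in the displayed law `2π(S₁ + S₁′|U|)·U²·4^{−m}`, `evalM` form. -/
theorem abs_evalM_klFlowPiece_sub_mean_le_of_readJetsF {G : GeoConsts} {Q : EngConsts} {β U μ : ℝ} (hμ : μ ∈ klWindowC) {m : ℕ}
    (h : TwoLegReadJetsF L M G Q β U μ m) (q : Momentum) :
    |evalM (klFlowPiece L M β U μ m) q - klAngularMean (fun θ => klLocalPart L M β U μ (klFlowFrameU L M β U μ m) m θ)| ≤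
      2 * π * ((G.S 1 + Q.S' 1 * |U|) * U ^ 2 * ((4 : ℝ) ^ m)⁻¹) := by
  rw [evalM_apply, ← curveJetBar_one]
  exact abs_eval_klFlowPiece_sub_mean_le_of_readJetsF hμ h _

/-- **From the registered history** `HistP klPredsV17F2 … n` (any dummy frame `K`): at every `m < n` the scale-`m` flow piece is within
`2π(S₁ + S₁′|U|)·U²·4^{−m}` of its constant part. -/
theorem abs_evalM_klFlowPiece_sub_mean_le_of_histP {G : GeoConsts} {P : SplitConsts} {Q : EngConsts} {R : RenConsts} {β U μ : ℝ}
    (hμ : μ ∈ klWindowC) {K : TrigPolyC4v} {n : ℕ} (hh : HistP klPredsV17F2 L M G P Q R β U μ K n) {m : ℕ} (hm : m < n) (q : Momentum) :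
    |evalM (klFlowPiece L M β U μ m) q - klAngularMean (fun θ => klLocalPart L M β U μ (klFlowFrameU L M β U μ m) m θ)| ≤
      2 * π * ((G.S 1 + Q.S' 1 * |U|) * U ^ 2 * ((4 : ℝ) ^ m)⁻¹) :=
  abs_evalM_klFlowPiece_sub_mean_le_of_readJetsF hμ ((histP_klPredsV17F2_iff L M G P Q R β U μ K n).1 hh m hm).2.2.2.1 q

/-! ## §4 The δμ bookkeeping: the constant parts from `RenormalisedAtF`, the flow frame as constants + mean-free pieces -/

/-- `Λ_m²/e₀ = e₀·16^{−m}` (`Λ_m = klScale klE0 m = e₀·4^{−m}`). -/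
theorem klScale_klE0_sq_div (m : ℕ) : klScale klE0 m ^ 2 / klE0 = klE0 * ((16 : ℝ) ^ m)⁻¹ := by
  unfold klScale klE0
  rw [show (16 : ℝ) ^ m = (4 : ℝ) ^ m * (4 : ℝ) ^ m by rw [← mul_pow]; norm_num]
  field_simp

/-- **The constant part of the piece from the registered history** (`RenormalisedAtF … (K_m) R m` at every `m < n`, k3c3-p1's
`abs_klAngularMean_localPart_le_of_renormalisedAtF`), in the law `R.cr·|U|·e₀·16^{−m}`. -/
theorem abs_klAngularMean_localPart_le_of_histP {G : GeoConsts} {P : SplitConsts} {Q : EngConsts} {R : RenConsts} {β U μ : ℝ}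
    {K : TrigPolyC4v} {n : ℕ} (hh : HistP klPredsV17F2 L M G P Q R β U μ K n) {m : ℕ} (hm : m < n) :
    |klAngularMean (fun θ => klLocalPart L M β U μ (klFlowFrameU L M β U μ m) m θ)| ≤ R.cr * |U| * (klE0 * ((16 : ℝ) ^ m)⁻¹) := by
  have h := abs_klAngularMean_localPart_le_of_renormalisedAtF L M
    ((histP_klPredsV17F2_iff L M G P Q R β U μ K n).1 hh m hm).2.1.1
  rwa [mul_div_assoc, klScale_klE0_sq_div] at h

/-- **The flow frame is minus the sum of the constant parts minus the sum of the mean-free pieces** (pointwise; `eval_klFlowFrameU`): the first sum is a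
chemical-potential shift of the band (`frameLevel_of_eval_eq_add_const`), only the second carries momentum dependence. -/
theorem eval_klFlowFrameU_eq_neg_sum_mean_sub (β U μ : ℝ) (n : ℕ) (p : Fin 2 → ℝ) :
    (klFlowFrameU L M β U μ n).eval p =
      -(∑ m ∈ range n, klAngularMean (fun θ => klLocalPart L M β U μ (klFlowFrameU L M β U μ m) m θ)) -
        ∑ m ∈ range n, ((klFlowPiece L M β U μ m).eval p -
          klAngularMean (fun θ => klLocalPart L M β U μ (klFlowFrameU L M β U μ m) m θ)) := by
  rw [eval_klFlowFrameU, Finset.sum_sub_distrib]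
  ring

/-- **The total δμ shift is `O(U)` uniformly in the depth**: from the history, `|Σ_{m<n} mean ν_m| ≤ (16/15)·R.cr·e₀·|U|` (`0 ≤ R.cr`). -/
theorem abs_sum_klAngularMean_localPart_le_of_histP {G : GeoConsts} {P : SplitConsts} {Q : EngConsts} {R : RenConsts} {β U μ : ℝ}
    (hR : 0 ≤ R.cr) {K : TrigPolyC4v} {n : ℕ} (hh : HistP klPredsV17F2 L M G P Q R β U μ K n) :
    |∑ m ∈ range n, klAngularMean (fun θ => klLocalPart L M β U μ (klFlowFrameU L M β U μ m) m θ)| ≤ 16 / 15 * (R.cr * klE0 * |U|) := by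
  refine (Finset.abs_sum_le_sum_abs _ _).trans ?_
  calc ∑ m ∈ range n, |klAngularMean (fun θ => klLocalPart L M β U μ (klFlowFrameU L M β U μ m) m θ)|
      ≤ ∑ m ∈ range n, R.cr * |U| * (klE0 * ((16 : ℝ) ^ m)⁻¹) :=
        Finset.sum_le_sum fun m hm => abs_klAngularMean_localPart_le_of_histP hh (Finset.mem_range.1 hm)
    _ = R.cr * klE0 * |U| * ∑ m ∈ range n, ((16 : ℝ)⁻¹) ^ m := by
        rw [Finset.mul_sum]; refine Finset.sum_congr rfl fun m _ => ?_; rw [inv_pow]; ring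
    _ ≤ R.cr * klE0 * |U| * (16 / 15) := by
        have hgeo : ∑ m ∈ range n, ((16 : ℝ)⁻¹) ^ m ≤ 16 / 15 := by
          have h := geom_sum_Ico_le_of_lt_one (m := 0) (n := n) (x := (16 : ℝ)⁻¹) (by norm_num) (by norm_num)
          rw [← Finset.range_eq_Ico] at h
          exact h.trans (by norm_num)
        have hk : (0 : ℝ) ≤ R.cr * klE0 * |U| := by unfold klE0; positivity
        exact mul_le_mul_of_nonneg_left hgeo hk
    _ = 16 / 15 * (R.cr * klE0 * |U|) := by ring

end Model

end Summit.HubbardSuperconductivity.HubbardSuperconductivity.Theorems.KLRegimeSplit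

end
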